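import Literature.Analysis.FluidPDE.AlbrittonBarkerForwardHolds
import Literature.Analysis.FluidPDE.LocalTypeILiouville
import Summits.NavierStokesRegularity.NavierStokesRegularity.Theorems.LiouvilleConjectureNS
import HarnessLib

/-!
# The Liouville conjecture (L) excludes local Type I singularities (Albritton–Barker 2019, §1)

Analysis/FluidPDE proof file (theorems only: no definition, no named fact, no `sorry`).  Nothing here
is a claim about Navier–Stokes regularity: every statement is CONDITIONAL on the OPEN Liouville
conjecture (L) of Koch–Nadirashvili–Seregin–Šverák 2009 (canonical obligation
`Summit.NavierStokesRegularity.NavierStokesRegularity.LiouvilleConjectureNS`, a conjecture LEAF that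
`Literature/` may import; transitional Literature copy `Literature.Analysis.FluidPDE.LiouvilleConjectureNS`
with the same definiens).

Albritton–Barker 2019, §1, after Thm. 1.1: "If true, the conjecture [(L): bounded mild ancient
solutions are constant] excludes Type I singularities" — for the local notion of the paper (a suitable
weak solution in a parabolic ball with a backward singular vertex and `𝐈 < ∞` over all sub-balls,
`Literature.Analysis.FluidPDE.LocalTypeISingularityExists`).  The tree had this only up to a
slice-measurability proviso (`LocalTypeILiouville.lean`:
`LiouvilleConjectureNS.not_nontrivialMildAncientTypeIExists_measurable` refutes, under (L), the variant
of `NontrivialMildAncientTypeIExists` whose witness has a.e.-strongly measurable slices, and that module's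
docstring records that the unconditional `(L) → ¬ NontrivialMildAncientTypeIExists` is NOT claimed,
the duality-form mild class carrying no per-slice measurability).  The blow-up procedure of
`AlbrittonBarkerForwardHolds.lean` (`LocalTypeIBlowup.exists_ancientMild_of_localTypeISingularPoint`,
Seregin–Šverák 2009, Thm. 2.8) produces from a local Type I singular point a non-trivial mild bounded
ancient solution with `𝐈 < ∞` whose slices are CONTINUOUS, hence measurable — exactly the witness the
measurable form refutes.  Hence, with no proviso left:

* `LiouvilleConjectureNS.not_localTypeISingularityExists` — (L) (Literature spelling) ⇒
  `¬ LocalTypeISingularityExists`;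
* `not_localTypeISingularityExists_of_liouvilleConjectureNS` — the same from the canonical Summits
  obligation (the two conjecture `def`s have the same definiens; the passage is definitional);
* `not_liouvilleConjectureNS_of_localTypeISingularityExists` — contrapositive packaging: a local
  Type I singular point refutes (L) ("constructing ancient solutions with Type I decay is a (difficult)
  route to obtaining Navier–Stokes singularities", A–B §1, read backwards);
* `LiouvilleConjectureNS.not_nontrivialMildAncientTypeIExists` and
  `not_nontrivialMildAncientTypeIExists_of_liouvilleConjectureNS` (appended) — the UNCONDITIONAL
  `(L) → ¬ NontrivialMildAncientTypeIExists` that `LocalTypeILiouville.lean` lists under "NOT proved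
  here": a witness of `NontrivialMildAncientTypeIExists` (no slice measurability assumed) gives a local
  Type I singular point by the tree's reverse half of A–B Thm. 1.1
  (`AlbrittonBarkerTypeICharacterization_holds.mpr`, i.e. `localTypeISingularityExists_of_nontrivialMildAncientTypeIExists`
  with `SuitableCompactness_holds`, `PersistenceOfSingularities_holds`), which the previous items exclude —
  the blow-up of that singular point is a NEW, measurable witness, so the measurability gap is by-passed
  rather than filled.

## References

* D. Albritton, T. Barker, *On local Type I singularities of the Navier–Stokes equations and
  Liouville theorems*, J. Math. Fluid Mech. 21 (2019) = arXiv:1811.00502, Thm. 1.1 and the paragraph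
  after it in §1. [AlbrittonBarker2019]
* G. Koch, N. Nadirashvili, G. Seregin, V. Šverák, Acta Math. 203 (2009), §1 (conjecture (L)).
  [KochNadirashviliSereginSverak2009]
* G. Seregin, V. Šverák, Comm. PDE 34 (2009) = arXiv:0804.1803, §1 ("scale-invariant estimate +
  Conjecture (L) ⇒ regularity") and Thm. 2.8. [SereginSverak2009]
-/

noncomputable section

open MeasureTheory Set Function Filter Topology TopologicalSpace Metric
open scoped NNReal ENNReal

namespace Literature.Analysis.FluidPDE

/-- **(L) excludes local Type I singularities** (Albritton–Barker 2019, §1 after Thm. 1.1: "If true,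
the conjecture excludes Type I singularities"; Seregin–Šverák 2009, §1: "scale invariant estimate +
Conjecture (L) ⇒ regularity").  Under the Liouville conjecture `LiouvilleConjectureNS` (Literature
spelling) there is no suitable weak solution with a local Type I singular point
(`LocalTypeISingularityExists`): the blow-up `LocalTypeIBlowup.exists_ancientMild_of_localTypeISingularPoint`
of such a point is a non-trivial mild bounded ancient solution with measurable (indeed continuous)
slices and `𝐈 < ∞`, which `LiouvilleConjectureNS.not_nontrivialMildAncientTypeIExists_measurable`
rules out. [cite: AlbrittonBarker2019, §1 (paragraph after Thm 1.1)] -/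
theorem LiouvilleConjectureNS.not_localTypeISingularityExists (hL : LiouvilleConjectureNS) :
    ¬ LocalTypeISingularityExists := by
  rintro ⟨r₀, z, u, p, hloc⟩
  obtain ⟨V, P, H, h1, h2, h3, h4, h5, h6⟩ :=
    LocalTypeIBlowup.exists_ancientMild_of_localTypeISingularPoint hloc
  exact hL.not_nontrivialMildAncientTypeIExists_measurable ⟨V, P, H, h1, h2, h3, h4, h5, h6⟩

/-- **(L) excludes local Type I singularities**, canonical spelling: the same implication from the
Summits-side conjecture obligation `Summit.NavierStokesRegularity.NavierStokesRegularity.LiouvilleConjectureNS`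
(same definiens as the transitional Literature copy, so the hypothesis transfers definitionally).
[cite: AlbrittonBarker2019, §1 (paragraph after Thm 1.1)] -/
theorem not_localTypeISingularityExists_of_liouvilleConjectureNS
    (hL : Summit.NavierStokesRegularity.NavierStokesRegularity.LiouvilleConjectureNS) :
    ¬ LocalTypeISingularityExists :=
  LiouvilleConjectureNS.not_localTypeISingularityExists (fun u hu hmeas t ht => hL u hu hmeas t ht)

/-- **A local Type I singular point refutes (L)** (contrapositive packaging of
`not_localTypeISingularityExists_of_liouvilleConjectureNS`; Albritton–Barker 2019, §1: Type I blow-up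
profiles are exactly the non-trivial mild bounded ancient solutions (L) forbids).
[cite: AlbrittonBarker2019, §1 (paragraph after Thm 1.1)] -/
theorem not_liouvilleConjectureNS_of_localTypeISingularityExists (h : LocalTypeISingularityExists) :
    ¬ Summit.NavierStokesRegularity.NavierStokesRegularity.LiouvilleConjectureNS :=
  fun hL => not_localTypeISingularityExists_of_liouvilleConjectureNS hL h

/-- **(L) refutes the second bullet of Albritton–Barker 2019, Thm. 1.1, with no measurability proviso**
(the implication `LocalTypeILiouville.lean` records as "NOT proved here"): under `LiouvilleConjectureNS`
(Literature spelling) there is no non-trivial mild bounded ancient solution with `𝐈 < ∞`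
(`NontrivialMildAncientTypeIExists`, slices NOT assumed measurable).  Proof: such a solution yields a
local Type I singular point by the reverse half of Thm. 1.1 (`AlbrittonBarkerTypeICharacterization_holds`,
zoom-out + compactness + persistence of singularities), excluded by
`LiouvilleConjectureNS.not_localTypeISingularityExists`. [cite: AlbrittonBarker2019, Thm 1.1 and §1 (paragraph after Thm 1.1)] -/
theorem LiouvilleConjectureNS.not_nontrivialMildAncientTypeIExists (hL : LiouvilleConjectureNS) :
    ¬ NontrivialMildAncientTypeIExists :=
  fun h => hL.not_localTypeISingularityExists (AlbrittonBarkerTypeICharacterization_holds.mpr h)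

/-- **(L) refutes the second bullet of Albritton–Barker 2019, Thm. 1.1**, canonical spelling of the
conjecture (`Summit.NavierStokesRegularity.NavierStokesRegularity.LiouvilleConjectureNS`, same definiens
as the Literature copy). [cite: AlbrittonBarker2019, Thm 1.1 and §1 (paragraph after Thm 1.1)] -/
theorem not_nontrivialMildAncientTypeIExists_of_liouvilleConjectureNS
    (hL : Summit.NavierStokesRegularity.NavierStokesRegularity.LiouvilleConjectureNS) :
    ¬ NontrivialMildAncientTypeIExists :=
  fun h => not_localTypeISingularityExists_of_liouvilleConjectureNS hL
    (AlbrittonBarkerTypeICharacterization_holds.mpr h)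

end Literature.Analysis.FluidPDE

end
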